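import Mathlib

/-!
# Compactness for banded quadratic digit phases — lemmas II: bit forms, blocks, the cut

Helper file for the stub `stub_compact` of the crux `MobiusLadder.QuadraticDigitPhases`
(stmt-QuantumAdvantage-1391), line `Sketch`.

A *bit form* is `Σ_{i,j ∈ T} h i j · xᵢ xⱼ + Σ_{i ∈ T} g i · xᵢ ∈ ZMod 2`, where `xᵢ = 𝟙[bit i of N]`;
the phase of the stub's hypothesis is `(-1)^{bit form}` with the window `T = range (N+1)`.  Contents
(all elementary, folklore):
* `sum_range_mul_block` — `Σ_{b<B} Σ_{a<H} f (H b + a) = Σ_{i<HB} f i`;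
* `abs_sum_le_sum_blocks` — if `χ = σ(b) · φ` on each aligned block `2^j b + [0, 2^j)` with
  `|σ| ≤ 1`, then `|Σ_{N<2^n} w χ| ≤ Σ_b |Σ_a w φ|` (the block statistic);
* `neg_one_pow_ite_eq_mul` — `(-1)^e = (-1)^{e+f} (-1)^f` in the `if … = 1` encoding;
* `bitForm_range_eq` — the window `range M` is immaterial once `N < 2^M`;
* `bitForm_eq_of_testBit_eq` — LOCALITY: if `g`, `h` vanish below `j`, the form only reads the
  digits `≥ j`;
* `abs_corr_le_block` — THE CUT: if `E(N) = c + (form of (qd, ld))(N)` for all `N`, `ld + lin`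
  vanishes below `j` and `qd + quad` lives on `[j, ∞)²`, then the correlation of `w` with `(-1)^E`
  on `[0, 2^n)` is at most the block statistic of `w` against the phase of `(quad, lin)` at block
  length `2^j`.
-/

set_option linter.dupNamespace false -- D-0017: single-problem summit ⇒ QuantumAdvantage.QuantumAdvantage by design

namespace Summit.QuantumAdvantage.QuantumAdvantage.Theorems.MobiusLadderQuadraticDigitPhasesStubCompact

open Finset

/-- Aligned blocks: `Σ_{b<B} Σ_{a<H} f (H b + a) = Σ_{i<HB} f i`. -/
theorem sum_range_mul_block {M : Type*} [AddCommMonoid M] (f : ℕ → M) (H B : ℕ) :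
    ∑ b ∈ range B, ∑ a ∈ range H, f (H * b + a) = ∑ i ∈ range (H * B), f i := by
  induction B with
  | zero => simp
  | succ B ih => rw [Finset.sum_range_succ, ih, Nat.mul_succ, Finset.sum_range_add]

/-- The block statistic dominates: if `χ = σ(b) · φ` on every aligned block `2^j b + [0, 2^j)`,
`b < 2^(n-j)`, with `|σ(b)| ≤ 1`, then `|Σ_{N<2^n} w(N) χ(N)| ≤ Σ_{b<2^(n-j)} |Σ_{a<2^j} (w φ)(2^j b + a)|`. -/
theorem abs_sum_le_sum_blocks (w χ φ σ : ℕ → ℝ) {j n : ℕ} (hjn : j ≤ n) (hσ : ∀ b, |σ b| ≤ 1)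
    (hcut : ∀ b < 2 ^ (n - j), ∀ a < 2 ^ j, χ (2 ^ j * b + a) = σ b * φ (2 ^ j * b + a)) :
    |∑ N ∈ range (2 ^ n), w N * χ N| ≤
      ∑ b ∈ range (2 ^ (n - j)), |∑ a ∈ range (2 ^ j), w (2 ^ j * b + a) * φ (2 ^ j * b + a)| := by
  have h2n : 2 ^ n = 2 ^ j * 2 ^ (n - j) := by rw [← pow_add, Nat.add_sub_cancel' hjn]
  rw [h2n, ← sum_range_mul_block]
  refine (Finset.abs_sum_le_sum_abs _ _).trans (Finset.sum_le_sum fun b hb => ?_)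
  have hb' : b < 2 ^ (n - j) := Finset.mem_range.mp hb
  have hblock : ∑ a ∈ range (2 ^ j), w (2 ^ j * b + a) * χ (2 ^ j * b + a) =
      σ b * ∑ a ∈ range (2 ^ j), w (2 ^ j * b + a) * φ (2 ^ j * b + a) := by
    rw [Finset.mul_sum]
    refine Finset.sum_congr rfl fun a ha => ?_
    rw [hcut b hb' a (Finset.mem_range.mp ha)]
    ring
  rw [hblock, abs_mul]
  exact mul_le_of_le_one_left (abs_nonneg _) (hσ b)

/-- Sign splitting: `(-1)^e = (-1)^t · (-1)^f` whenever `e + f = t` in `ZMod 2`. -/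
theorem neg_one_pow_ite_eq_mul (e f t : ZMod 2) (h : e + f = t) :
    (if e = 1 then (-1 : ℝ) else 1) = (if t = 1 then (-1 : ℝ) else 1) * (if f = 1 then (-1 : ℝ) else 1) := by
  subst h
  have h11 : (1 : ZMod 2) + 1 = 0 := by decide
  have key : ∀ u : ZMod 2, u = 0 ∨ u = 1 := by decide
  rcases key e with rfl | rfl <;> rcases key f with rfl | rfl <;> simp [h11]

/-- The window is immaterial: the bit form over `range M` equals the one over `range M'` as soon as
`N < 2^M` and `N < 2^{M'}` (digits of `N` at positions `≥ M` vanish). -/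
theorem bitForm_range_eq (h : ℕ → ℕ → ZMod 2) (g : ℕ → ZMod 2) {N M M' : ℕ} (hM : N < 2 ^ M)
    (hM' : N < 2 ^ M') :
    (∑ i ∈ range M, ∑ j ∈ range M, h i j * (if Nat.testBit N i then (1 : ZMod 2) else 0) *
          (if Nat.testBit N j then (1 : ZMod 2) else 0)) +
        ∑ i ∈ range M, g i * (if Nat.testBit N i then (1 : ZMod 2) else 0) =
      (∑ i ∈ range M', ∑ j ∈ range M', h i j * (if Nat.testBit N i then (1 : ZMod 2) else 0) *
          (if Nat.testBit N j then (1 : ZMod 2) else 0)) +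
        ∑ i ∈ range M', g i * (if Nat.testBit N i then (1 : ZMod 2) else 0) := by
  wlog hle : M ≤ M' generalizing M M'
  · exact (this hM' hM (le_of_not_ge hle)).symm
  have hbit : ∀ i, i ∈ range M' → i ∉ range M → Nat.testBit N i = false := fun i _ hi =>
    Nat.testBit_lt_two_pow (hM.trans_le (Nat.pow_le_pow_right two_pos (by simpa using hi)))
  have hsub : range M ⊆ range M' := Finset.range_subset_range.mpr hle
  congr 1
  · rw [Finset.sum_subset hsub (fun i hi hi' => by simp [hbit i hi hi'])]
    refine Finset.sum_congr rfl fun i _ => ?_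
    exact Finset.sum_subset hsub (fun j hj hj' => by simp [hbit j hj hj'])
  · exact Finset.sum_subset hsub (fun i hi hi' => by simp [hbit i hi hi'])

/-- LOCALITY of bit forms: if `g` vanishes below `j` and `h i i' ≠ 0` forces `j ≤ i, i'`, then the form
depends only on the digits of `N` at positions `≥ j`. -/
theorem bitForm_eq_of_testBit_eq (T : Finset ℕ) (h : ℕ → ℕ → ZMod 2) (g : ℕ → ZMod 2) {j : ℕ}
    (hg : ∀ i < j, g i = 0) (hh : ∀ i i', h i i' ≠ 0 → j ≤ i ∧ j ≤ i') {N N' : ℕ}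
    (hNN' : ∀ i, j ≤ i → Nat.testBit N i = Nat.testBit N' i) :
    (∑ i ∈ T, ∑ i' ∈ T, h i i' * (if Nat.testBit N i then (1 : ZMod 2) else 0) *
          (if Nat.testBit N i' then (1 : ZMod 2) else 0)) +
        ∑ i ∈ T, g i * (if Nat.testBit N i then (1 : ZMod 2) else 0) =
      (∑ i ∈ T, ∑ i' ∈ T, h i i' * (if Nat.testBit N' i then (1 : ZMod 2) else 0) *
          (if Nat.testBit N' i' then (1 : ZMod 2) else 0)) +
        ∑ i ∈ T, g i * (if Nat.testBit N' i then (1 : ZMod 2) else 0) := by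
  congr 1
  · refine Finset.sum_congr rfl fun i _ => Finset.sum_congr rfl fun i' _ => ?_
    by_cases hz : h i i' = 0
    · simp [hz]
    · obtain ⟨hi, hi'⟩ := hh i i' hz
      rw [hNN' i hi, hNN' i' hi']
  · refine Finset.sum_congr rfl fun i _ => ?_
    by_cases hi : i < j
    · simp [hg i hi]
    · rw [hNN' i (not_lt.mp hi)]

/-- THE CUT.  Suppose `E(N) = c + Σ_{i,i'<n} qd i i' xᵢ xᵢ' + Σ_{i<n} ld i xᵢ` for all `N` (`x` = digits
of `N`), `ld i + lin i = 0` for `i < j`, and `qd i i' + quad i i' ≠ 0 ⇒ j ≤ i, i'`.  Then on every aligned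
block `2^j b + [0, 2^j)` below `2^n` the phase `(-1)^{E(N)}` is `±` the phase of the (infinite) form
`(quad, lin)` at `N` (window `range (N+1)`), so the correlation of any weight `w` with `(-1)^E` on
`[0, 2^n)` is at most the block statistic of `w` against that phase at block length `2^j`. -/
theorem abs_corr_le_block {j n : ℕ} (hjn : j ≤ n) (w : ℕ → ℝ) (E : ℕ → ZMod 2) (c : ZMod 2)
    (qd quad : ℕ → ℕ → ZMod 2) (ld lin : ℕ → ZMod 2)
    (hE : ∀ N, E N = c +
      ((∑ i ∈ range n, ∑ i' ∈ range n, qd i i' * (if Nat.testBit N i then (1 : ZMod 2) else 0) *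
          (if Nat.testBit N i' then (1 : ZMod 2) else 0)) +
        ∑ i ∈ range n, ld i * (if Nat.testBit N i then (1 : ZMod 2) else 0)))
    (hg : ∀ i < j, ld i + lin i = 0) (hh : ∀ i i', qd i i' + quad i i' ≠ 0 → j ≤ i ∧ j ≤ i') :
    |∑ N ∈ range (2 ^ n), w N * (if E N = 1 then (-1 : ℝ) else 1)| ≤
      ∑ b ∈ range (2 ^ (n - j)), |∑ a ∈ range (2 ^ j), w (2 ^ j * b + a) *
        (if (∑ i ∈ range (2 ^ j * b + a + 1), ∑ i' ∈ range (2 ^ j * b + a + 1),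
              quad i i' * (if Nat.testBit (2 ^ j * b + a) i then (1 : ZMod 2) else 0) *
                (if Nat.testBit (2 ^ j * b + a) i' then (1 : ZMod 2) else 0)) +
            ∑ i ∈ range (2 ^ j * b + a + 1),
              lin i * (if Nat.testBit (2 ^ j * b + a) i then (1 : ZMod 2) else 0) = 1
          then (-1 : ℝ) else 1)| := by
  refine abs_sum_le_sum_blocks w (fun N => if E N = 1 then (-1 : ℝ) else 1)
    (fun N => if (∑ i ∈ range (N + 1), ∑ i' ∈ range (N + 1),
          quad i i' * (if Nat.testBit N i then (1 : ZMod 2) else 0) *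
            (if Nat.testBit N i' then (1 : ZMod 2) else 0)) +
        ∑ i ∈ range (N + 1), lin i * (if Nat.testBit N i then (1 : ZMod 2) else 0) = 1
      then (-1 : ℝ) else 1)
    (fun b => if c +
      ((∑ i ∈ range n, ∑ i' ∈ range n, (qd i i' + quad i i') *
          (if Nat.testBit (2 ^ j * b) i then (1 : ZMod 2) else 0) *
          (if Nat.testBit (2 ^ j * b) i' then (1 : ZMod 2) else 0)) +
        ∑ i ∈ range n, (ld i + lin i) * (if Nat.testBit (2 ^ j * b) i then (1 : ZMod 2) else 0)) = 1
      then -1 else 1)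
    hjn (fun b => by split_ifs <;> simp) ?_
  intro b hb a ha
  have hNn : 2 ^ j * b + a < 2 ^ n :=
    calc 2 ^ j * b + a < 2 ^ j * b + 2 ^ j := by omega
      _ = 2 ^ j * (b + 1) := by ring
      _ ≤ 2 ^ j * 2 ^ (n - j) := Nat.mul_le_mul_left _ hb
      _ = 2 ^ n := by rw [← pow_add, Nat.add_sub_cancel' hjn]
  have hN1 : 2 ^ j * b + a < 2 ^ (2 ^ j * b + a + 1) :=
    Nat.lt_two_pow_self.trans (Nat.pow_lt_pow_right (by norm_num) (Nat.lt_succ_self _))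
  have hbits : ∀ i, j ≤ i → Nat.testBit (2 ^ j * b + a) i = Nat.testBit (2 ^ j * b) i := by
    intro i hi
    rw [Nat.testBit_two_pow_mul_add b ha, if_neg (not_lt.mpr hi), Nat.testBit_two_pow_mul]
    simp [hi]
  refine neg_one_pow_ite_eq_mul _ _ _ ?_
  rw [hE, bitForm_range_eq quad lin hN1 hNn,
    ← bitForm_eq_of_testBit_eq (range n) (fun i i' => qd i i' + quad i i') (fun i => ld i + lin i)
      hg hh hbits]
  simp only [add_mul, Finset.sum_add_distrib]
  ring

end Summit.QuantumAdvantage.QuantumAdvantage.Theorems.MobiusLadderQuadraticDigitPhasesStubCompact
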